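import Summits.MatrixMultiplication.MatrixMultiplication.Theorems.LongExchangeCondensationLongExchangeSound
import HarnessLib

/-!
# Route `LongExchangeCondensation`: the on-path lemma of the rung `LongExchangeSound`, made visible to
# structural automation

The forward discipline (TRIBUNAL-FIT F4) asks the rung `LongExchangeSound` (stmt-MatrixMultiplication-20136,
PROVED: `LongExchangeSound_of`) to come with a LANDED on-path lemma `S → C`; it is landed
(`LongExchangeSound_of_MatrixMultiplication`, file `LongExchangeCondensationLongExchangeSound.lean`), but an
untagged theorem is invisible to the tribunal kernel's cheap `S → C` portfolio (`exact fun h => h` / `simpa` /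
`intro h; aesop` / `tauto` / projections), and `MatrixMultiplication` (`ω(ℂ) = 2`) shares no structure with the
rung (an exact-cost soundness statement for Plücker-exchange derivations), so no structural tactic finds it.

This file registers the landed on-path lemma as an `aesop` **safe apply rule** (recipe of the on-path landers,
`run/shared/lean/fwd/onpath-landed.jsonl`, row fwd2-land-3-g2 2026-08-18T17:20Z, validated on route
`KinematicRung`: tier `full` closes `S → C` by `intro h; aesop`).  The rule concludes the opaque route constant
`LongExchangeCondensation.LongExchangeSound` only, so it fires only on goals that literally ask for this rung and
reduces them to the Statement `MatrixMultiplication`; nothing concluding the Statement is tagged, and the route's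
other binder `ShortLongCondensation` (summit-strength, open) is untouched, so no conjunct split is trivialised.

The `example` at the end is the kernel's literal forward goal, closed by the kernel's literal portfolio tactic.

prover-fwd2-land-2-g2-0 (on-path lander, gen 2), 2026-08-18.
-/

set_option linter.dupNamespace false

namespace Summit.MatrixMultiplication.MatrixMultiplication.Theorems.LongExchangeSound

open Summit.MatrixMultiplication.MatrixMultiplication.Theses.LongExchangeCondensation

attribute [aesop safe apply] LongExchangeSound_of_MatrixMultiplication

/-- **On-path record, packaged.** The rung holds outright AND follows from the Statement: the pair
(`LongExchangeSound_of`, `LongExchangeSound_of_MatrixMultiplication`) as one conjunction, so that a seat citing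
"the rung of route `LongExchangeCondensation` is proved and on-path" has a single name. [folklore] -/
theorem longExchangeSound_and_onPath :
    LongExchangeSound ∧ (_root_.MatrixMultiplication → LongExchangeSound) :=
  ⟨LongExchangeSound_of, LongExchangeSound_of_MatrixMultiplication⟩

/- The kernel's literal forward `S → C` goal, closed by its literal portfolio tactic. -/
example : _root_.MatrixMultiplication → LongExchangeSound := by
  intro h; aesop

end Summit.MatrixMultiplication.MatrixMultiplication.Theorems.LongExchangeSound
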